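import Summits.CriticalPhenomena.Ising3DConformalLimit.Theorems.CoerciveSharpnessPhiCoerciveSplit
import Mathlib.Analysis.SpecialFunctions.Pow.Asymptotics

/-!
# Route `CoerciveSharpness`, crux `PhiCoercive` (stmt-CriticalPhenomena-18196), line `box-superset`:
# the growth dichotomy for `SupersetStable`

Helper file of the line lead (`--supports stmt-CriticalPhenomena-18196`, registered stub
`stub_supersetStable_of_growth`).  The shape piece of the crux,
`SupersetStable : ∃ c' > 0, ∀ m ≥ 1, ∀ finite S ⊇ Λ_m, ∃ r ≥ m, c'·φ(Λ_r) ≤ φ(S)`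
(`Theorems/CoerciveSharpnessPhiCoerciveSplit.lean`), has content ONLY IN THE GROWTH REGIME
`φ(Λ_r) → ∞`: if the box fluxes do not tend to infinity, some level `L` is undershot by `φ(Λ_r)` for
arbitrarily large `r`, and Duminil-Copin–Tassion's `φ_{β_c}(S) ≥ 1` (`one_le_phiC`) gives
`SupersetStable` with `c' = 1/L` (`supersetStable_of_not_tendsto`).  Hence the dichotomy glue
`stub_supersetStable_of_growth : (Tendsto (φ ∘ Λ) atTop atTop → SupersetStable) → SupersetStable`,
through which the line's registered composition stub is the growth-regime implication
`stub_supersetStableInGrowth` (skeleton `Cruxes/PhiCoercive/Lines/box_superset.lean`); and under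
`BoxCoercive` the hypothesis holds anyway (`boxFlux_tendsto_of_boxCoercive`).

References: H. Duminil-Copin, V. Tassion, CMP 343 (2016), arXiv:1502.03050 §2.1 (`φ_{β_c}(S) ≥ 1`);
H. Duminil-Copin, R. Panis, CMP 406 (2025), arXiv:2404.05700, Def. 1.1 (`φ_β(S)`).
No definition, no `sorry`.
-/

noncomputable section

namespace Summit.CriticalPhenomena.Ising3DConformalLimit.Cruxes.PhiCoercive.BoxSuperset

open scoped BigOperators
open Finset Filter
open Literature.Probability.LatticeModels

/-- `φ_{β_c}(Λ_r) > 0` (indeed `≥ 1`, Duminil-Copin–Tassion 2016). [cite: DuminilCopinTassionCMP2016, §2.1] -/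
theorem phiC_box_pos (r : ℕ) : 0 < phiC (box 3 r) :=
  lt_of_lt_of_le one_pos (one_le_phiC (zero_mem_box 3 r))

/-- **Bounded branch of the dichotomy.** If `φ_{β_c}(Λ_r) ↛ ∞` then `SupersetStable` holds: take the
boxes `Λ_r`, `r ≥ m`, with `φ(Λ_r) ≤ L` as witnesses and use `φ(S) ≥ 1`. [cite: DuminilCopinTassionCMP2016, §2.1] -/
theorem supersetStable_of_not_tendsto
    (h : ¬ Tendsto (fun r : ℕ => phiC (box 3 r)) atTop atTop) : SupersetStable := by
  rw [Filter.tendsto_atTop_atTop] at h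
  push Not at h
  obtain ⟨L, hL⟩ := h
  have hLpos : 0 < L := by
    obtain ⟨r, -, hr⟩ := hL 0
    exact (phiC_box_pos r).trans hr
  refine ⟨1 / L, by positivity, fun m _ S hS => ?_⟩
  obtain ⟨r, hmr, hr⟩ := hL m
  refine ⟨r, hmr, ?_⟩
  calc 1 / L * phiC (box 3 r) ≤ 1 / L * L :=
        mul_le_mul_of_nonneg_left hr.le (by positivity)
    _ = 1 := by field_simp
    _ ≤ phiC S := one_le_phiC (zero_mem_of_box_subset hS)

/-- **Registered stub `stub_supersetStable_of_growth` (the dichotomy glue)**: the growth-regime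
implication suffices for `SupersetStable` (classical case split on `φ(Λ_r) → ∞`). [folklore] -/
theorem stub_supersetStable_of_growth :
    (Tendsto (fun r : ℕ => phiC (box 3 r)) atTop atTop → SupersetStable) → SupersetStable := by
  intro h
  by_cases hT : Tendsto (fun r : ℕ => phiC (box 3 r)) atTop atTop
  · exact h hT
  · exact supersetStable_of_not_tendsto hT

/-- Under `BoxCoercive` the box fluxes tend to infinity, so on the line `box-superset` the bounded
branch is vacuous and `SupersetStable` is consumed only in the growth regime. [folklore] -/
theorem boxFlux_tendsto_of_boxCoercive (hB : BoxCoercive) :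
    Tendsto (fun r : ℕ => phiC (box 3 r)) atTop atTop := by
  obtain ⟨κ, c, hκ, hc, hbox⟩ := hB
  have hpow : Tendsto (fun r : ℕ => c * (r : ℝ) ^ κ) atTop atTop :=
    Tendsto.const_mul_atTop hc
      ((tendsto_rpow_atTop hκ).comp tendsto_natCast_atTop_atTop)
  refine tendsto_atTop_mono' atTop ?_ hpow
  filter_upwards [eventually_ge_atTop 1] with r hr using hbox r hr

/-- In the growth regime `SupersetStable` says: no finite superset of `Λ_m` radiates less than a
fixed fraction of the LEAST box flux from scale `m` on — the form in which it is a shape-universality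
statement (`inf_{r ≥ m} φ(Λ_r) → ∞`). Recorded as the equivalent "eventual" reading used by the lead's
census: from `SupersetStable` and growth, `φ(S) ≥ c'·φ(Λ_r) ≥ c'·M` for every `S ⊇ Λ_m` once
`φ(Λ_r) ≥ M` for all `r ≥ m`. [folklore] -/
theorem phiC_superset_large_of_supersetStable (hS : SupersetStable)
    (hT : Tendsto (fun r : ℕ => phiC (box 3 r)) atTop atTop) (M : ℝ) :
    ∃ m₀ : ℕ, ∀ m : ℕ, m₀ ≤ m → ∀ S : Finset (Site 3), box 3 m ⊆ S →
      ∃ c' : ℝ, 0 < c' ∧ c' * M ≤ phiC S := by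
  obtain ⟨c', hc', h⟩ := hS
  rw [Filter.tendsto_atTop_atTop] at hT
  obtain ⟨r₀, hr₀⟩ := hT M
  refine ⟨max r₀ 1, fun m hm S hSm => ⟨c', hc', ?_⟩⟩
  obtain ⟨r, hmr, hr⟩ := h m (le_trans (le_max_right _ _) hm) S hSm
  have hM : M ≤ phiC (box 3 r) := hr₀ r (le_trans (le_trans (le_max_left _ _) hm) hmr)
  exact le_trans (mul_le_mul_of_nonneg_left hM hc'.le) hr

end Summit.CriticalPhenomena.Ising3DConformalLimit.Cruxes.PhiCoercive.BoxSuperset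

end
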